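import Summits.HodgeConjecture.HodgeConjecture.Theorems.Ring2WeilCoverageNormClassEq
import Summits.HodgeConjecture.HodgeConjecture.Theorems.Ring2WeilCoverageNormTableC
import HarnessLib

/-!
# Weil-type family coverage — product windows, part L: THE FIBRE-PRODUCT / PILLOWCASE WINDOW over `ℚ(√-3)` and two kit folds

research route conditional on HC_CM; not a corollary; Q11.4-sentence-2 already refuted in dim ≥ 3.

Ring 2, WEIL-TYPE FAMILY-COVERAGE CENSUS (`HOME/WEIL-FAMILY-COVERAGE.md` `## b04`, block b04.15, owner ring2-b04, gen 51); twelfth part of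
`Ring2WeilCoverageProductWindow`.  LITERAL CLASSES only (exact rational arithmetic; engines `bigwin.py` = the product-window hidden factor
computed on the coset cover `Y = C̃/(H₁ × Stab(0))` WITHOUT enumerating `G = G₁ × G₂` (sheets = `(H₁\\G₁) × points`, `P₂ = 1 − Tr`),
`polywin.py` = the pillowcase Belyi map of a lattice polygon, `symwin.py` = random realisation of cycle-type data; mirror
`HOME/pub-hodge-ring2-b04/census-g51/`), each with its CELL IDENTIFICATION.  What the data instantiate (census b04.15 (A)–(C), seat-derived):
* THEOREM S8 (PRYM FORM of the product-window law): for ANY `C_k`-equivariant cover `f : Y → D` of degree `n` (`k ∈ {3,4,6}`, `K = ℚ(ζ_k)`),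
  the `λ`-part `B` of the Prym `P(Y/D)` with the polarisation induced from `J(Y)` has `[det H|_B] = [n]^{r₁}·u^{m}` in `ℚˣ/Nm(Kˣ)`
  (`r₁ = dim_K H¹(D)_λ`, `m = dim_K B`, `u = [2]` for `k = 3, 6`, `u = 1` for `k = 4`); no 2-transitivity is needed (pull-back scaling +
  LEMMA C′ of b04.14 on `Y` and on `D`).  With `D = E_ω` (`k = 3`, branch exponents `(1,1,1)`): `r₁ = 1`, `[a_B] = [n]`.
* THEOREM S9 (trigonal form): for a rational function `φ` of degree `n` whose fibres over `{0,1,∞}` contain exactly six points of multiplicity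
  `≡ 1` and three of multiplicity `≡ 2 (mod 3)` (all others `≡ 0`), `Y_φ : y³ = φ(φ−1)` has genus 7 and `B_φ = P(Y_φ/E_ω)` is a `(3,3)`
  WEIL-TYPE abelian sixfold with `ℤ[ω]`-multiplication on the component `(3, ℚ(√-3), a ≡ n)`.
* THEOREM S10 (pillowcase polygons): the double of a lattice 9-gon `P` in the `A₂` alcove lattice with three corners each of `60°`, `120°`,
  `240°` is such a `φ_P`, Belyi, of degree `n = #alcoves(P)`; explicit families give EVERY `n ≥ 7`, hence EVERY component
  `(3, ℚ(√-3), [a])` contains the Prym of an explicit genus-7 trigonal curve over `ℚ̄` — below: `n = 7, 8 (R1 = W6.3.2), 9, 10, 11, 17,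
  20 (R2 = W6.3.5), 22 (W6.3.22, the last named R2 class), 23, 34`.
* §1: the folds of kit j202603 (habitat2 D-1 ×3: `C₄ × AGL(1,7)` tenfold family on `W10.1.7`) and j195790 (ring2-b06's `C₃ × AGL(1,11)`
  rigid tenfold on `W10.3.11` ×3), both as pre-registered in `census-g50/THEOREMS-S7.md` §7.

No `def`, no named fact, no `sorry`; nothing here is a statement about Hodge classes; `HC_CM` is used nowhere.
Re-land (docstring only, ref1 A-177.1): the `n = 7` datum's monodromy group is exactly `PSL₂(7)` (order 168), not «≥ A₇»; all declarations
byte-identical otherwise.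
References: [cite: vanGeemen1994HodgeAV, (5.4.1), Lemma 5.2]; [cite: Serre1973, Ch. III §1].
-/

set_option linter.dupNamespace false

open Literature.AlgebraicGeometry.Motives
open Literature.AlgebraicGeometry.VanGeemen1994
open Summit.HodgeConjecture.HodgeConjecture.Ring2.Hypotheses

namespace Summit.HodgeConjecture.HodgeConjecture.Ring2.WeilCoverage

namespace SqrtNeg3

/-- `23 ∉ Nm(ℚ(√-3)ˣ)`: descent at the inert prime `23` (`-3` is a non-square mod `23`, `23 ∥ 23`); `T(23) = {3, 23}` — the row key of
`W6.3.23`. research route conditional on HC_CM; not a corollary; Q11.4-sentence-2 already refuted in dim ≥ 3. [cite: Serre1973, Ch. III §1] -/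
theorem not_mem_23 : Units.mk0 (23 : ℚ) (by norm_num) ∉ normUnitsSubgroup ℚ (weilField 3) := by
  simpa using natCast_not_mem_normUnitsSubgroup_of_inert (d := 3) (a := 23) (p := 23)
    (by norm_num) (by decide) (by norm_num) (by norm_num) (by norm_num)

end SqrtNeg3

/-! ### §1 Folds of kit j202603 (`C₄ × AGL(1,7)`, habitat2 D-1 ×3) and j195790 (`C₃ × AGL(1,11)`, ring2-b06 ×3) -/
/-- `C4xF42`-cover `(0; c0:6B,c1:222,c1:222,c2:6A)` (genus 99, Hurwitz dimension 1; engine `prodwin.py` on the Galois cover, exact): the HIDDEN FACTOR `B = V^{H₁×Stab(0)}` of the `(λ⊗ρ)`-piece — an abelian TENFOLD with `(5,5)` `ℚ(√-1)`-action, WEIL TYPE — has literal `det H|_B = -1360488960/15463`, `a = 1360488960/15463`, `T(a) = [2, 7]`: row `W10.1.7` (NON-split); `r₁ = dim_K H¹(D)_λ = 1`, `r_H = 11`. THEOREM S8 (Prym form of the product-window law, census b04.15 (A): `[a_B] = [n]^{r₁}`, no 2-transitivity needed) predicts `T(a_B) = [2, 7]` from `r₁ = 1`, `n = 7` — CONF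IRMED.
research route conditional on HC_CM; not a corollary; Q11.4-sentence-2 already refuted in dim ≥ 3. [cite: vanGeemen1994HodgeAV, (5.4.1)] -/
theorem pw_C4F42_n7_f0e8f7_mk_detH_ne_split :
    (QuotientGroup.mk (Units.mk0 (((-1360488960 : ℚ) / 15463)) (by norm_num)) : weilNormResidueGroup 1) ≠
      splitDiscriminantClass 5 1 := by
  have e : Units.mk0 (((-1360488960 : ℚ) / 15463)) (by norm_num) = -(Units.mk0 ((1360488960 : ℚ) / 15463) (by norm_num)) := Units.ext (by norm_num)
  rw [Ne, e, mk_neg_eq_splitDiscriminantClass_iff_of_odd (n := 5) (by decide)]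
  have h := mul_not_mem_normUnitsSubgroup (mem_normUnitsSubgroup_of_sq_add_mul_sq (d := 1) (a := ((1360488960 : ℚ) / 108241)) (by norm_num) ((11664 : ℚ) / 329) ((34992 : ℚ) / 329) (by norm_num))
    Summit.HodgeConjecture.Ring2WeilNormDescent.seven_not_mem_norm_one
  rw [mk0_mul_mk0] at h
  norm_num at h
  exact h

/-- The same datum, CELL IDENTIFICATION: `[det H|_B] = [-7]` in `ℚˣ/Nm(ℚ(√-1)ˣ)` — the census ROW KEY of `W10.1.7` (`a·7 = ((1360488960 : ℚ) / 2209) = (((11664 : ℚ) / 47))² + 1·(((34992 : ℚ) / 47))²`).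
research route conditional on HC_CM; not a corollary; Q11.4-sentence-2 already refuted in dim ≥ 3. [cite: vanGeemen1994HodgeAV, Lemma 5.2 (3)] -/
theorem pw_C4F42_n7_f0e8f7_mk_detH_eq_key :
    (QuotientGroup.mk (Units.mk0 (-(((1360488960 : ℚ) / 15463))) (neg_ne_zero.2 (by norm_num))) : weilNormResidueGroup 1) =
      QuotientGroup.mk (Units.mk0 (-(7 : ℚ)) (neg_ne_zero.2 (by norm_num))) :=
  mk_neg_eq_mk_neg_of_mul_mem (by norm_num) (by norm_num)
    (mem_normUnitsSubgroup_of_sq_add_mul_sq _ ((11664 : ℚ) / 47) ((34992 : ℚ) / 47) (by norm_num))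

/-- `C3xAGL111`-cover `(0; c1:10A,c1:10A,c1:55A)` (genus 144, Hurwitz dimension 0; engine `prodwin.py` on the Galois cover, exact): the HIDDEN FACTOR `B = V^{H₁×Stab(0)}` of the `(λ⊗ρ)`-piece — an abelian TENFOLD with `(5,5)` `ℚ(√-3)`-action, WEIL TYPE — has literal `det H|_B = -640000000000/33`, `a = 640000000000/33`, `T(a) = [3, 11]`: row `W10.3.11` (NON-split); `r₁ = dim_K H¹(D)_λ = 1`, `r_H = 11`. THEOREM S6 (product-window law, census b04.13 (A)) predicts `T(a_B) = [3, 11]` from `r₁ = 1`, `r_H = 11` — CONFIRMED.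
research route conditional on HC_CM; not a corollary; Q11.4-sentence-2 already refuted in dim ≥ 3. [cite: vanGeemen1994HodgeAV, (5.4.1)] -/
theorem pw_C3AGL111_n11_c4c69e_mk_detH_ne_split :
    (QuotientGroup.mk (Units.mk0 (((-640000000000 : ℚ) / 33)) (by norm_num)) : weilNormResidueGroup 3) ≠
      splitDiscriminantClass 5 3 := by
  have e : Units.mk0 (((-640000000000 : ℚ) / 33)) (by norm_num) = -(Units.mk0 ((640000000000 : ℚ) / 33) (by norm_num)) := Units.ext (by norm_num)
  rw [Ne, e, mk_neg_eq_splitDiscriminantClass_iff_of_odd (n := 5) (by decide)]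
  have h := mul_not_mem_normUnitsSubgroup (mem_normUnitsSubgroup_of_sq_add_mul_sq (d := 3) (a := ((640000000000 : ℚ) / 363)) (by norm_num) (0 : ℚ) ((800000 : ℚ) / 33) (by norm_num))
    Summit.HodgeConjecture.Ring2WeilNormDescent.eleven_not_mem_norm_three
  rw [mk0_mul_mk0] at h
  norm_num at h
  exact h

/-- The same datum, CELL IDENTIFICATION: `[det H|_B] = [-11]` in `ℚˣ/Nm(ℚ(√-3)ˣ)` — the census ROW KEY of `W10.3.11` (`a·11 = ((640000000000 : ℚ) / 3) = ((0 : ℚ))² + 3·(((800000 : ℚ) / 3))²`).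
research route conditional on HC_CM; not a corollary; Q11.4-sentence-2 already refuted in dim ≥ 3. [cite: vanGeemen1994HodgeAV, Lemma 5.2 (3)] -/
theorem pw_C3AGL111_n11_c4c69e_mk_detH_eq_key :
    (QuotientGroup.mk (Units.mk0 (-(((640000000000 : ℚ) / 33))) (neg_ne_zero.2 (by norm_num))) : weilNormResidueGroup 3) =
      QuotientGroup.mk (Units.mk0 (-(11 : ℚ)) (neg_ne_zero.2 (by norm_num))) :=
  mk_neg_eq_mk_neg_of_mul_mem (by norm_num) (by norm_num)
    (mem_normUnitsSubgroup_of_sq_add_mul_sq _ (0 : ℚ) ((800000 : ℚ) / 3) (by norm_num))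

/-! ### §2 THE PILLOWCASE WINDOW over `ℚ(√-3)`: Pryms `P(Y_P/E_ω)` of the genus-7 trigonal curves `y³ = φ_P(φ_P − 1)`, `n = 7 … 23` -/

/-- PILLOWCASE datum (A₂ alcove lattice, orbifold `ℙ¹(3,3,3) = E_ω/C₃`): the double of the lattice 9-gon `P` with turning sequence `-1,+1,+2,-1,+1,+2,-1,+1,+2` (×60°) and side lengths `1,1,1,1,1,1,1,1,1` is a Belyi map `φ_P : ℙ¹ → ℙ¹` of degree `n = 7` (= number of alcoves of `P`) with passport `(4.2.1, 4.2.1, 4.2.1)` and monodromy group `PSL₂(7) = L₃(2)` in its 2-transitive action on 7 points (order 168 = the certified Schreier–Sims lower bound; so this is also a `C₃ × L₃(2)` product-window datum — ref1 A-177.1); `Y_P : y³ = φ_P(φ_P − 1)` (genus 7) is the normalised fibre product `E ×_{ℙ¹} ℙ¹_{φ_P}` (21 sheets over `ℙ¹`; engine `bigwin.py`, exact) and the HIDDEN FACTOR `B` = the `λ`-part of the Prym `P(Y_P/E)` — an abelian SIXFOLD with `(3,3)` `ℚ(√-3)`-action, WEIL TYPE — has literal `det H|_B = -64/7`, `a =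 64/7`, `T(a) = []`: row `W6.3.1` (SPLIT); `r₁ = dim_K H¹(D)_λ = 1`, `r_H = 7`. THEOREM S8 (Prym form of the product-window law, census b04.15 (A): `[a_B] = [n]^{r₁}`, no 2-transitivity needed) predicts `T(a_B) = []` from `r₁ = 1`, `n = 7` — CONFIRMED.
research route conditional on HC_CM; not a corollary; Q11.4-sentence-2 already refuted in dim ≥ 3. The split class is witnessed constructively: `a = (((20 : ℚ) / 7))² + 3·(((4 : ℚ) / 7))²`. [cite: vanGeemen1994HodgeAV, (5.4.1)] -/
theorem pillow3_C3A7_n7_b6fd2d_mk_detH_eq_split :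
    (QuotientGroup.mk (Units.mk0 (((-64 : ℚ) / 7)) (by norm_num)) : weilNormResidueGroup 3) =
      splitDiscriminantClass 3 3 := by
  have e : Units.mk0 (((-64 : ℚ) / 7)) (by norm_num) = -(Units.mk0 ((64 : ℚ) / 7) (by norm_num)) := Units.ext (by norm_num)
  rw [e, mk_neg_eq_splitDiscriminantClass_iff_of_odd (n := 3) (by decide)]
  exact mem_normUnitsSubgroup_of_sq_add_mul_sq _ ((20 : ℚ) / 7) ((4 : ℚ) / 7) (by norm_num)

/-- PILLOWCASE datum (A₂ alcove lattice, orbifold `ℙ¹(3,3,3) = E_ω/C₃`): the double of the lattice 9-gon `P` with turning sequence `-1,-1,+2,+1,+1,-1,+2,+1,+2` (×60°) and side lengths `1,1,1,1,1,1,1,2,1` is a Belyi map `φ_P : ℙ¹ → ℙ¹` of degree `n = 8` (= number of alcoves of `P`) with passport `(4.3.1, 4.2.1^2, 4.2^2)` and monodromy group `S8` (certified lower bound 40320); `Y_P : y³ = φ_P(φ_P − 1)` (genus 7) is the normalised fibre product `E ×_{ℙ¹} ℙ¹_{φ_P}` (24 sheets over `ℙ¹`; engine `bigwin.py`, exact)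 and the HIDDEN FACTOR `B` = the `λ`-part of the Prym `P(Y_P/E)` — an abelian SIXFOLD with `(3,3)` `ℚ(√-3)`-action, WEIL TYPE — has literal `det H|_B = -8`, `a = 8`, `T(a) = [2, 3]`: row `W6.3.2` (NON-split); `r₁ = dim_K H¹(D)_λ = 1`, `r_H = 7`. THEOREM S8 (Prym form of the product-window law, census b04.15 (A): `[a_B] = [n]^{r₁}`, no 2-transitivity needed) predicts `T(a_B) = [2, 3]` from `r₁ = 1`, `n = 8` — CONFIRMED.
research route conditional on HC_CM; not a corollary; Q11.4-sentence-2 already refuted in dim ≥ 3. [cite: vanGeemen1994HodgeAV, (5.4.1)] -/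
theorem pillow3_C3S8_n8_90fd28_mk_detH_ne_split :
    (QuotientGroup.mk (Units.mk0 ((-8 : ℚ)) (by norm_num)) : weilNormResidueGroup 3) ≠
      splitDiscriminantClass 3 3 := by
  have e : Units.mk0 ((-8 : ℚ)) (by norm_num) = -(Units.mk0 (8 : ℚ) (by norm_num)) := Units.ext (by norm_num)
  rw [Ne, e, mk_neg_eq_splitDiscriminantClass_iff_of_odd (n := 3) (by decide)]
  have h := mul_not_mem_normUnitsSubgroup (mem_normUnitsSubgroup_of_sq_add_mul_sq (d := 3) (a := (4 : ℚ)) (by norm_num) (2 : ℚ) (0 : ℚ) (by norm_num))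
    Summit.HodgeConjecture.Ring2WeilNormDescent.two_not_mem_norm_three
  rw [mk0_mul_mk0] at h
  norm_num at h
  exact h

-- CELL IDENTIFICATION of this datum (`[det H|_B] = [-8] = [-2]`, the ROW KEY of `W6.3.2` = R1): the literal statement is ALREADY in the tree as
-- `Summit.HodgeConjecture.HodgeConjecture.Ring2.WeilCoverage.pwC6S3_c53_c22_c52_q0_g10_mk_detH_eq_key` (part K, habitat2's `C₆ × S₃` surface datum has the same
-- literal `det H = -8`) — reused by name, not restated.

/-- PILLOWCASE datum (A₂ alcove lattice, orbifold `ℙ¹(3,3,3) = E_ω/C₃`): the double of the lattice 9-gon `P` with turning sequence `-1,-1,+1,+2,-1,+2,+1,+1,+2` (×60°) and side lengths `1,1,1,1,1,1,3,1,1` is a Belyi map `φ_P : ℙ¹ → ℙ¹` of degree `n = 9` (= number of alcoves of `P`) with passport `(4.2.1^3, 4.3.2, 4.3.2)` and monodromy group `A9` (certified lower bound 181440); `Y_P : y³ = φ_P(φ_P − 1)` (genus 7) is the normalised fibre product `E ×_{ℙ¹} ℙ¹_{φ_P}` (27 sheets over `ℙ¹`; engine `bigwin.py`, exact) and the HIDDEN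 FACTOR `B` = the `λ`-part of the Prym `P(Y_P/E)` — an abelian SIXFOLD with `(3,3)` `ℚ(√-3)`-action, WEIL TYPE — has literal `det H|_B = -64/9`, `a = 64/9`, `T(a) = []`: row `W6.3.1` (SPLIT); `r₁ = dim_K H¹(D)_λ = 1`, `r_H = 7`. THEOREM S8 (Prym form of the product-window law, census b04.15 (A): `[a_B] = [n]^{r₁}`, no 2-transitivity needed) predicts `T(a_B) = []` from `r₁ = 1`, `n = 9` — CONFIRMED.
research route conditional on HC_CM; not a corollary; Q11.4-sentence-2 already refuted in dim ≥ 3. The split class is witnessed constructively: `a = (((8 : ℚ) / 3))² + 3·((0 : ℚ))²`. [cite: vanGeemen1994HodgeAV, (5.4.1)] -/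
theorem pillow3_C3A9_n9_782713_mk_detH_eq_split :
    (QuotientGroup.mk (Units.mk0 (((-64 : ℚ) / 9)) (by norm_num)) : weilNormResidueGroup 3) =
      splitDiscriminantClass 3 3 := by
  have e : Units.mk0 (((-64 : ℚ) / 9)) (by norm_num) = -(Units.mk0 ((64 : ℚ) / 9) (by norm_num)) := Units.ext (by norm_num)
  rw [e, mk_neg_eq_splitDiscriminantClass_iff_of_odd (n := 3) (by decide)]
  exact mem_normUnitsSubgroup_of_sq_add_mul_sq _ ((8 : ℚ) / 3) (0 : ℚ) (by norm_num)

/-- PILLOWCASE datum (A₂ alcove lattice, orbifold `ℙ¹(3,3,3) = E_ω/C₃`): the double of the lattice 9-gon `P` with turning sequence `-1,-1,+1,+1,+2,-1,+1,+2,+2` (×60°) and side lengths `1,1,1,1,1,1,1,3,2` is a Belyi map `φ_P : ℙ¹ → ℙ¹` of degree `n = 10` (= number of alcoves of `P`) with passport `(4.3.2.1, 4.2^2.1^2, 4.3^2)` and monodromy group `S10` (certified lower bound 3628800); `Y_P : y³ = φ_P(φ_P − 1)` (genus 7) is the normalised fibre product `E ×_{ℙ¹} ℙ¹_{φ_P}`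 (30 sheets over `ℙ¹`; engine `bigwin.py`, exact) and the HIDDEN FACTOR `B` = the `λ`-part of the Prym `P(Y_P/E)` — an abelian SIXFOLD with `(3,3)` `ℚ(√-3)`-action, WEIL TYPE — has literal `det H|_B = -32/5`, `a = 32/5`, `T(a) = [2, 5]`: row `W6.3.10` (NON-split); `r₁ = dim_K H¹(D)_λ = 1`, `r_H = 7`. THEOREM S8 (Prym form of the product-window law, census b04.15 (A): `[a_B] = [n]^{r₁}`, no 2-transitivity needed) predicts `T(a_B) = [2, 5]` from `r₁ = 1`, `n = 10` — CONFIRMED.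
research route conditional on HC_CM; not a corollary; Q11.4-sentence-2 already refuted in dim ≥ 3. [cite: vanGeemen1994HodgeAV, (5.4.1)] -/
theorem pillow3_C3S10_n10_adea65_mk_detH_ne_split :
    (QuotientGroup.mk (Units.mk0 (((-32 : ℚ) / 5)) (by norm_num)) : weilNormResidueGroup 3) ≠
      splitDiscriminantClass 3 3 := by
  have e : Units.mk0 (((-32 : ℚ) / 5)) (by norm_num) = -(Units.mk0 ((32 : ℚ) / 5) (by norm_num)) := Units.ext (by norm_num)
  rw [Ne, e, mk_neg_eq_splitDiscriminantClass_iff_of_odd (n := 3) (by decide)]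
  have h := mul_not_mem_normUnitsSubgroup (mem_normUnitsSubgroup_of_sq_add_mul_sq (d := 3) (a := ((16 : ℚ) / 25)) (by norm_num) ((4 : ℚ) / 5) (0 : ℚ) (by norm_num))
    Summit.HodgeConjecture.Ring2WeilNormDescent.ten_not_mem_norm_three
  rw [mk0_mul_mk0] at h
  norm_num at h
  exact h

/-- The same datum, CELL IDENTIFICATION: `[det H|_B] = [-10]` in `ℚˣ/Nm(ℚ(√-3)ˣ)` — the census ROW KEY of `W6.3.10` (`a·10 = (64 : ℚ) = ((8 : ℚ))² + 3·((0 : ℚ))²`).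
research route conditional on HC_CM; not a corollary; Q11.4-sentence-2 already refuted in dim ≥ 3. [cite: vanGeemen1994HodgeAV, Lemma 5.2 (3)] -/
theorem pillow3_C3S10_n10_adea65_mk_detH_eq_key :
    (QuotientGroup.mk (Units.mk0 (-(((32 : ℚ) / 5))) (neg_ne_zero.2 (by norm_num))) : weilNormResidueGroup 3) =
      QuotientGroup.mk (Units.mk0 (-(10 : ℚ)) (neg_ne_zero.2 (by norm_num))) :=
  mk_neg_eq_mk_neg_of_mul_mem (by norm_num) (by norm_num)
    (mem_normUnitsSubgroup_of_sq_add_mul_sq _ (8 : ℚ) (0 : ℚ) (by norm_num))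

/-- PILLOWCASE datum (A₂ alcove lattice, orbifold `ℙ¹(3,3,3) = E_ω/C₃`): the double of the lattice 9-gon `P` with turning sequence `-1,-1,-1,+2,+1,+1,+1,+2,+2` (×60°) and side lengths `1,1,1,1,1,1,2,3,2` is a Belyi map `φ_P : ℙ¹ → ℙ¹` of degree `n = 11` (= number of alcoves of `P`) with passport `(4.3.2.1^2, 4^2.2.1, 3^3.2)` and monodromy group `S11` (certified lower bound 39916800); `Y_P : y³ = φ_P(φ_P − 1)` (genus 7) is the normalised fibre product `E ×_{ℙ¹} ℙ¹_{φ_P}` (33 sheets over `ℙ¹`; engine `bigwin.py`, exact) and the HIDDEN FACTOR `B` = the `λ`-part of the Prym `P(Y_P/E)` — an abelian SIXFOLD with `(3,3)` `ℚ(√-3)`-action, WEIL TYPE — has literal `det H|_B = -192/11`, `a = 192/11`, `T(a) = [3, 11]`: row `W6.3.11` (NON-split); `r₁ = dim_K H¹(D)_λ = 1`, `r_H = 7`. THEOREM S8 (Prym form of the product-window law, census b04.15 (A): `[a_B] = [n]^{r₁}`, no 2-transitivity needed) predicts `T(a_B) = [3, 11]` from `r₁ = 1`, `n = 11` — CONF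IRMED.
research route conditional on HC_CM; not a corollary; Q11.4-sentence-2 already refuted in dim ≥ 3. [cite: vanGeemen1994HodgeAV, (5.4.1)] -/
theorem pillow3_C3S11_n11_fb36af_mk_detH_ne_split :
    (QuotientGroup.mk (Units.mk0 (((-192 : ℚ) / 11)) (by norm_num)) : weilNormResidueGroup 3) ≠
      splitDiscriminantClass 3 3 := by
  have e : Units.mk0 (((-192 : ℚ) / 11)) (by norm_num) = -(Units.mk0 ((192 : ℚ) / 11) (by norm_num)) := Units.ext (by norm_num)
  rw [Ne, e, mk_neg_eq_splitDiscriminantClass_iff_of_odd (n := 3) (by decide)]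
  have h := mul_not_mem_normUnitsSubgroup (mem_normUnitsSubgroup_of_sq_add_mul_sq (d := 3) (a := ((192 : ℚ) / 121)) (by norm_num) (0 : ℚ) ((8 : ℚ) / 11) (by norm_num))
    Summit.HodgeConjecture.Ring2WeilNormDescent.eleven_not_mem_norm_three
  rw [mk0_mul_mk0] at h
  norm_num at h
  exact h

/-- The same datum, CELL IDENTIFICATION: `[det H|_B] = [-11]` in `ℚˣ/Nm(ℚ(√-3)ˣ)` — the census ROW KEY of `W6.3.11` (`a·11 = (192 : ℚ) = ((0 : ℚ))² + 3·((8 : ℚ))²`).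
research route conditional on HC_CM; not a corollary; Q11.4-sentence-2 already refuted in dim ≥ 3. [cite: vanGeemen1994HodgeAV, Lemma 5.2 (3)] -/
theorem pillow3_C3S11_n11_fb36af_mk_detH_eq_key :
    (QuotientGroup.mk (Units.mk0 (-(((192 : ℚ) / 11))) (neg_ne_zero.2 (by norm_num))) : weilNormResidueGroup 3) =
      QuotientGroup.mk (Units.mk0 (-(11 : ℚ)) (neg_ne_zero.2 (by norm_num))) :=
  mk_neg_eq_mk_neg_of_mul_mem (by norm_num) (by norm_num)
    (mem_normUnitsSubgroup_of_sq_add_mul_sq _ (0 : ℚ) (8 : ℚ) (by norm_num))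

/-- PILLOWCASE datum (A₂ alcove lattice, orbifold `ℙ¹(3,3,3) = E_ω/C₃`): the double of the lattice 9-gon `P` with turning sequence `-1,-1,-1,+2,+1,+1,+1,+2,+2` (×60°) and side lengths `1,1,1,1,1,1,3,3,3` is a Belyi map `φ_P : ℙ¹ → ℙ¹` of degree `n = 17` (= number of alcoves of `P`) with passport `(4.3^2.2^2.1^3, 4^2.3^3, 3^5.2)` and monodromy group `S17` (certified lower bound 355687428096000); `Y_P : y³ = φ_P(φ_P − 1)` (genus 7) is the normalised fibre product `E ×_{ℙ¹} ℙ¹_{φ_P}` (51 sheets over `ℙ¹`; engine `bigwin.py`, exact) and the HIDDEN FACTOR `B` = the `λ`-part of the Prym `P(Y_P/E)` — an abelian SIXFOLD with `(3,3)` `ℚ(√-3)`-action, WEIL TYPE — has literal `det H|_B = -64/17`, `a = 64/17`, `T(a) = [3, 17]`: row `W6.3.17` (NON-split); `r₁ = dim_K H¹(D)_λ = 1`, `r_H = 7`. THEOREM S8 (Prym form of the product-window law, census b04.15 (A): `[a_B] = [n]^{r₁}`, no 2-transitivity needed) predicts `T(a_B) = [3, 17]` from `r₁ = 1`, `n = 17`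 — CONFIRMED.
research route conditional on HC_CM; not a corollary; Q11.4-sentence-2 already refuted in dim ≥ 3. [cite: vanGeemen1994HodgeAV, (5.4.1)] -/
theorem pillow3_C3S17_n17_58ed49_mk_detH_ne_split :
    (QuotientGroup.mk (Units.mk0 (((-64 : ℚ) / 17)) (by norm_num)) : weilNormResidueGroup 3) ≠
      splitDiscriminantClass 3 3 := by
  have e : Units.mk0 (((-64 : ℚ) / 17)) (by norm_num) = -(Units.mk0 ((64 : ℚ) / 17) (by norm_num)) := Units.ext (by norm_num)
  rw [Ne, e, mk_neg_eq_splitDiscriminantClass_iff_of_odd (n := 3) (by decide)]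
  have h := mul_not_mem_normUnitsSubgroup (mem_normUnitsSubgroup_of_sq_add_mul_sq (d := 3) (a := ((64 : ℚ) / 289)) (by norm_num) ((8 : ℚ) / 17) (0 : ℚ) (by norm_num))
    Summit.HodgeConjecture.HodgeConjecture.Ring2.WeilCoverage.SqrtNeg3.not_mem_17
  rw [mk0_mul_mk0] at h
  norm_num at h
  exact h

/-- The same datum, CELL IDENTIFICATION: `[det H|_B] = [-17]` in `ℚˣ/Nm(ℚ(√-3)ˣ)` — the census ROW KEY of `W6.3.17` (`a·17 = (64 : ℚ) = ((8 : ℚ))² + 3·((0 : ℚ))²`).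
research route conditional on HC_CM; not a corollary; Q11.4-sentence-2 already refuted in dim ≥ 3. [cite: vanGeemen1994HodgeAV, Lemma 5.2 (3)] -/
theorem pillow3_C3S17_n17_58ed49_mk_detH_eq_key :
    (QuotientGroup.mk (Units.mk0 (-(((64 : ℚ) / 17))) (neg_ne_zero.2 (by norm_num))) : weilNormResidueGroup 3) =
      QuotientGroup.mk (Units.mk0 (-(17 : ℚ)) (neg_ne_zero.2 (by norm_num))) :=
  mk_neg_eq_mk_neg_of_mul_mem (by norm_num) (by norm_num)
    (mem_normUnitsSubgroup_of_sq_add_mul_sq _ (8 : ℚ) (0 : ℚ) (by norm_num))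

/-- PILLOWCASE datum (A₂ alcove lattice, orbifold `ℙ¹(3,3,3) = E_ω/C₃`): the double of the lattice 9-gon `P` with turning sequence `-1,-1,-1,+1,+2,+1,+1,+2,+2` (×60°) and side lengths `1,1,1,5,1,6,2,3,2` is a Belyi map `φ_P : ℙ¹ → ℙ¹` of degree `n = 20` (= number of alcoves of `P`) with passport `(4.3^4.2.1^2, 4^2.3^3.2.1, 3^6.2)` and monodromy group `S20` (certified lower bound 2432902008176640000); `Y_P : y³ = φ_P(φ_P − 1)` (genus 7) is the normalised fibre product `E ×_{ℙ¹} ℙ¹_{φ_P}` (60 sheets over `ℙ¹`; engine `bigwin.py`, exact) and the HIDDEN FACTOR `B` = the `λ`-part of the Prym `P(Y_P/E)` — an abelian SIXFOLD with `(3,3)` `ℚ(√-3)`-action, WEIL TYPE — has literal `det H|_B = -48/5`, `a = 48/5`, `T(a) = [3, 5]`: row `W6.3.5` (NON-split); `r₁ = dim_K H¹(D)_λ = 1`, `r_H = 7`. THEOREM S8 (Prym form of the product-window law, census b04.15 (A): `[a_B] = [n]^{r₁}`, no 2-transitivity needed) predicts `T(a_B) = [3, 5]` from `r₁ = 1`,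 `n = 20` — CONFIRMED.
research route conditional on HC_CM; not a corollary; Q11.4-sentence-2 already refuted in dim ≥ 3. [cite: vanGeemen1994HodgeAV, (5.4.1)] -/
theorem pillow3_C3S20_n20_250e87_mk_detH_ne_split :
    (QuotientGroup.mk (Units.mk0 (((-48 : ℚ) / 5)) (by norm_num)) : weilNormResidueGroup 3) ≠
      splitDiscriminantClass 3 3 := by
  have e : Units.mk0 (((-48 : ℚ) / 5)) (by norm_num) = -(Units.mk0 ((48 : ℚ) / 5) (by norm_num)) := Units.ext (by norm_num)
  rw [Ne, e, mk_neg_eq_splitDiscriminantClass_iff_of_odd (n := 3) (by decide)]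
  have h := mul_not_mem_normUnitsSubgroup (mem_normUnitsSubgroup_of_sq_add_mul_sq (d := 3) (a := ((48 : ℚ) / 25)) (by norm_num) (0 : ℚ) ((4 : ℚ) / 5) (by norm_num))
    Summit.HodgeConjecture.Ring2WeilNormDescent.five_not_mem_norm_three
  rw [mk0_mul_mk0] at h
  norm_num at h
  exact h

/-- The same datum, CELL IDENTIFICATION: `[det H|_B] = [-5]` in `ℚˣ/Nm(ℚ(√-3)ˣ)` — the census ROW KEY of `W6.3.5` (`a·5 = (48 : ℚ) = ((0 : ℚ))² + 3·((4 : ℚ))²`).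
research route conditional on HC_CM; not a corollary; Q11.4-sentence-2 already refuted in dim ≥ 3. [cite: vanGeemen1994HodgeAV, Lemma 5.2 (3)] -/
theorem pillow3_C3S20_n20_250e87_mk_detH_eq_key :
    (QuotientGroup.mk (Units.mk0 (-(((48 : ℚ) / 5))) (neg_ne_zero.2 (by norm_num))) : weilNormResidueGroup 3) =
      QuotientGroup.mk (Units.mk0 (-(5 : ℚ)) (neg_ne_zero.2 (by norm_num))) :=
  mk_neg_eq_mk_neg_of_mul_mem (by norm_num) (by norm_num)
    (mem_normUnitsSubgroup_of_sq_add_mul_sq _ (0 : ℚ) (4 : ℚ) (by norm_num))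

/-- PILLOWCASE datum (A₂ alcove lattice, orbifold `ℙ¹(3,3,3) = E_ω/C₃`): the double of the lattice 9-gon `P` with turning sequence `-1,-1,+1,+1,+1,+2,-1,+2,+2` (×60°) and side lengths `1,1,1,1,2,3,3,2,2` is a Belyi map `φ_P : ℙ¹ → ℙ¹` of degree `n = 22` (= number of alcoves of `P`) with passport `(4.3^5.2.1, 4.3^5.2.1, 4.3^5.2.1)` and monodromy group `A22` (certified lower bound 562000363888803840000); `Y_P : y³ = φ_P(φ_P − 1)` (genus 7) is the normalised fibre product `E ×_{ℙ¹} ℙ¹_{φ_P}` (66 sheets over `ℙ¹`; engine `bigwin.py`, exact) and the HIDDEN FACTOR `B` = the `λ`-part of the Prym `P(Y_P/E)` — an abelian SIXFOLD with `(3,3)` `ℚ(√-3)`-action, WEIL TYPE — has literal `det H|_B = -864/11`, `a = 864/11`, `T(a) = [2, 11]`: row `W6.3.22` (NON-split); `r₁ = dim_K H¹(D)_λ = 1`, `r_H = 7`. THEOREM S8 (Prym form of the product-window law, census b04.15 (A): `[a_B] = [n]^{r₁}`, no 2-transitivity needed) predicts `T(a_B) = [2, 11]` from `r₁ = 1`,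 `n = 22` — CONFIRMED.
research route conditional on HC_CM; not a corollary; Q11.4-sentence-2 already refuted in dim ≥ 3. [cite: vanGeemen1994HodgeAV, (5.4.1)] -/
theorem pillow3_C3A22_n22_f3a3f4_mk_detH_ne_split :
    (QuotientGroup.mk (Units.mk0 (((-864 : ℚ) / 11)) (by norm_num)) : weilNormResidueGroup 3) ≠
      splitDiscriminantClass 3 3 := by
  have e : Units.mk0 (((-864 : ℚ) / 11)) (by norm_num) = -(Units.mk0 ((864 : ℚ) / 11) (by norm_num)) := Units.ext (by norm_num)
  rw [Ne, e, mk_neg_eq_splitDiscriminantClass_iff_of_odd (n := 3) (by decide)]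
  have h := mul_not_mem_normUnitsSubgroup (mem_normUnitsSubgroup_of_sq_add_mul_sq (d := 3) (a := ((432 : ℚ) / 121)) (by norm_num) (0 : ℚ) ((12 : ℚ) / 11) (by norm_num))
    Summit.HodgeConjecture.Ring2WeilNormDescent.twentyTwo_not_mem_norm_three
  rw [mk0_mul_mk0] at h
  norm_num at h
  exact h

/-- The same datum, CELL IDENTIFICATION: `[det H|_B] = [-22]` in `ℚˣ/Nm(ℚ(√-3)ˣ)` — the census ROW KEY of `W6.3.22` (`a·22 = (1728 : ℚ) = ((0 : ℚ))² + 3·((24 : ℚ))²`).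
research route conditional on HC_CM; not a corollary; Q11.4-sentence-2 already refuted in dim ≥ 3. [cite: vanGeemen1994HodgeAV, Lemma 5.2 (3)] -/
theorem pillow3_C3A22_n22_f3a3f4_mk_detH_eq_key :
    (QuotientGroup.mk (Units.mk0 (-(((864 : ℚ) / 11))) (neg_ne_zero.2 (by norm_num))) : weilNormResidueGroup 3) =
      QuotientGroup.mk (Units.mk0 (-(22 : ℚ)) (neg_ne_zero.2 (by norm_num))) :=
  mk_neg_eq_mk_neg_of_mul_mem (by norm_num) (by norm_num)
    (mem_normUnitsSubgroup_of_sq_add_mul_sq _ (0 : ℚ) (24 : ℚ) (by norm_num))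

/-- PILLOWCASE datum (A₂ alcove lattice, orbifold `ℙ¹(3,3,3) = E_ω/C₃`): the double of the lattice 9-gon `P` with turning sequence `-1,-1,+1,+1,+1,+2,-1,+2,+2` (×60°) and side lengths `1,1,2,1,2,3,2,3,2` is a Belyi map `φ_P : ℙ¹ → ℙ¹` of degree `n = 23` (= number of alcoves of `P`) with passport `(4.3^5.2.1^2, 4^2.3^4.2.1, 3^7.2)` and monodromy group `S23` (certified lower bound 25852016738884976640000); `Y_P : y³ = φ_P(φ_P − 1)` (genus 7) is the normalised fibre product `E ×_{ℙ¹} ℙ¹_{φ_P}` (69 sheets over `ℙ¹`; engine `bigwin.py`, exact) and the HIDDEN FACTOR `B` = the `λ`-part of the Prym `P(Y_P/E)` — an abelian SIXFOLD with `(3,3)` `ℚ(√-3)`-action, WEIL TYPE — has literal `det H|_B = -768/23`, `a = 768/23`, `T(a) = [3, 23]`: row `W6.3.23` (NON-split); `r₁ = dim_K H¹(D)_λ = 1`, `r_H = 7`. THEOREM S8 (Prym form of the product-window law, census b04.15 (A): `[a_B] = [n]^{r₁}`, no 2-transitivity needed) predicts `T(a_B) = [3, 23]` from `r₁ = 1`,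 `n = 23` — CONFIRMED.
research route conditional on HC_CM; not a corollary; Q11.4-sentence-2 already refuted in dim ≥ 3. [cite: vanGeemen1994HodgeAV, (5.4.1)] -/
theorem pillow3_C3S23_n23_e9ea0a_mk_detH_ne_split :
    (QuotientGroup.mk (Units.mk0 (((-768 : ℚ) / 23)) (by norm_num)) : weilNormResidueGroup 3) ≠
      splitDiscriminantClass 3 3 := by
  have e : Units.mk0 (((-768 : ℚ) / 23)) (by norm_num) = -(Units.mk0 ((768 : ℚ) / 23) (by norm_num)) := Units.ext (by norm_num)
  rw [Ne, e, mk_neg_eq_splitDiscriminantClass_iff_of_odd (n := 3) (by decide)]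
  have h := mul_not_mem_normUnitsSubgroup (mem_normUnitsSubgroup_of_sq_add_mul_sq (d := 3) (a := ((768 : ℚ) / 529)) (by norm_num) (0 : ℚ) ((16 : ℚ) / 23) (by norm_num))
    SqrtNeg3.not_mem_23
  rw [mk0_mul_mk0] at h
  norm_num at h
  exact h

/-- The same datum, CELL IDENTIFICATION: `[det H|_B] = [-23]` in `ℚˣ/Nm(ℚ(√-3)ˣ)` — the census ROW KEY of `W6.3.23` (`a·23 = (768 : ℚ) = ((0 : ℚ))² + 3·((16 : ℚ))²`).
research route conditional on HC_CM; not a corollary; Q11.4-sentence-2 already refuted in dim ≥ 3. [cite: vanGeemen1994HodgeAV, Lemma 5.2 (3)] -/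
theorem pillow3_C3S23_n23_e9ea0a_mk_detH_eq_key :
    (QuotientGroup.mk (Units.mk0 (-(((768 : ℚ) / 23))) (neg_ne_zero.2 (by norm_num))) : weilNormResidueGroup 3) =
      QuotientGroup.mk (Units.mk0 (-(23 : ℚ)) (neg_ne_zero.2 (by norm_num))) :=
  mk_neg_eq_mk_neg_of_mul_mem (by norm_num) (by norm_num)
    (mem_normUnitsSubgroup_of_sq_add_mul_sq _ (0 : ℚ) (16 : ℚ) (by norm_num))

/-! ### §3 `n = 34` (`W6.3.34`): cycle-type data realised by random permutations in `A₃₄` / `S₃₄` (kit j204632; one rigid datum and one one-parameter family) -/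

/-- FIBRE-PRODUCT datum `C3xA34` `(0; c1:12.9.6.3^2.1,c1:3^11.1,c1:3^11.1)` (cycle types in `A34`; Hurwitz dimension 0; realised by explicit permutations with product one, generation: randomized Schreier-Sims lower bound = 34!/2): `Y = D ×_{ℙ¹} X` (genus 10; `D` the `C3`-quotient datum = the CM elliptic curve, `X` the degree-34 cover, genus 3), computed on its 102 sheets (engine `bigwin.py`, exact); the HIDDEN FACTOR `B` = the `λ`-part of the Prym `P(Y/D)` — an abelian SIXFOLD with `(3,3)` `ℚ(√-3)`-action, WEIL TYPE — has literal `det H|_B = -32/153`, `a = 32/153`, `T(a) = [2, 17]`: row `W6.3.34` (NON-split); `r₁ = dim_K H¹(D)_λ = 1`, `r_H = 7`. THEOREM S8 (Prym form of the product-window law, census b04.15 (A): `[a_B] = [n]^{r₁}`, no 2-transitivity needed) predicts `T(a_B) = [2, 17]` from `r₁ = 1`, `n = 34` — CONFIRMED.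
research route conditional on HC_CM; not a corollary; Q11.4-sentence-2 already refuted in dim ≥ 3. [cite: vanGeemen1994HodgeAV, (5.4.1)] -/
theorem fibre3_C3A34_n34_0fbde1_mk_detH_ne_split :
    (QuotientGroup.mk (Units.mk0 (((-32 : ℚ) / 153)) (by norm_num)) : weilNormResidueGroup 3) ≠
      splitDiscriminantClass 3 3 := by
  have e : Units.mk0 (((-32 : ℚ) / 153)) (by norm_num) = -(Units.mk0 ((32 : ℚ) / 153) (by norm_num)) := Units.ext (by norm_num)
  rw [Ne, e, mk_neg_eq_splitDiscriminantClass_iff_of_odd (n := 3) (by decide)]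
  have h := mul_not_mem_normUnitsSubgroup (mem_normUnitsSubgroup_of_sq_add_mul_sq (d := 3) (a := ((16 : ℚ) / 2601)) (by norm_num) ((4 : ℚ) / 51) (0 : ℚ) (by norm_num))
    Summit.HodgeConjecture.HodgeConjecture.Ring2.WeilCoverage.SqrtNeg3.not_mem_34
  rw [mk0_mul_mk0] at h
  norm_num at h
  exact h

/-- The same datum, CELL IDENTIFICATION: `[det H|_B] = [-34]` in `ℚˣ/Nm(ℚ(√-3)ˣ)` — the census ROW KEY of `W6.3.34` (`a·34 = ((64 : ℚ) / 9) = (((8 : ℚ) / 3))² + 3·((0 : ℚ))²`).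
research route conditional on HC_CM; not a corollary; Q11.4-sentence-2 already refuted in dim ≥ 3. [cite: vanGeemen1994HodgeAV, Lemma 5.2 (3)] -/
theorem fibre3_C3A34_n34_0fbde1_mk_detH_eq_key :
    (QuotientGroup.mk (Units.mk0 (-(((32 : ℚ) / 153))) (neg_ne_zero.2 (by norm_num))) : weilNormResidueGroup 3) =
      QuotientGroup.mk (Units.mk0 (-(34 : ℚ)) (neg_ne_zero.2 (by norm_num))) :=
  mk_neg_eq_mk_neg_of_mul_mem (by norm_num) (by norm_num)
    (mem_normUnitsSubgroup_of_sq_add_mul_sq _ ((8 : ℚ) / 3) (0 : ℚ) (by norm_num))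

/-- FIBRE-PRODUCT datum `C3xS34` `(0; c1:12.6^2.3^3.1,c1:3^11.1,c1:3^11.1,c0:2.1^32)` (cycle types in `S34`; Hurwitz dimension 1 — a ONE-PARAMETER FAMILY; realised by explicit permutations with product one, generation: 2-transitive + Jordan (a 2-cycle as the 1-th power of a branch cycle, 2 <= n-3) => monodromy >= A_34): `Y = D ×_{ℙ¹} X` (genus 10; `D` the `C3`-quotient datum = the CM elliptic curve, `X` the degree-34 cover, genus 3), computed on its 102 sheets (engine `bigwin.py`, exact); the HIDDEN FACTOR `B` = the `λ`-part of the Prym `P(Y/D)` — an abelian SIXFOLD with `(3,3)` `ℚ(√-3)`-action, WEIL TYPE — has literal `det H|_B = -32/51`, `a = 32/51`, `T(a) = [2, 17]`: row `W6.3.34` (NON-split); `r₁ = dim_K H¹(D)_λ = 1`, `r_H = 7`. THEOREM S8 (Prym form of the product-window law, census b04.15 (A): `[a_B] = [n]^{r₁}`, no 2-transitivity needed) predicts `T(a_B) = [2, 17]` from `r₁ = 1`, `n = 34` — CONFIRMED.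
research route conditional on HC_CM; not a corollary; Q11.4-sentence-2 already refuted in dim ≥ 3. [cite: vanGeemen1994HodgeAV, (5.4.1)] -/
theorem fibre3_C3S34_n34_cfa4d1_mk_detH_ne_split :
    (QuotientGroup.mk (Units.mk0 (((-32 : ℚ) / 51)) (by norm_num)) : weilNormResidueGroup 3) ≠
      splitDiscriminantClass 3 3 := by
  have e : Units.mk0 (((-32 : ℚ) / 51)) (by norm_num) = -(Units.mk0 ((32 : ℚ) / 51) (by norm_num)) := Units.ext (by norm_num)
  rw [Ne, e, mk_neg_eq_splitDiscriminantClass_iff_of_odd (n := 3) (by decide)]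
  have h := mul_not_mem_normUnitsSubgroup (mem_normUnitsSubgroup_of_sq_add_mul_sq (d := 3) (a := ((16 : ℚ) / 867)) (by norm_num) (0 : ℚ) ((4 : ℚ) / 51) (by norm_num))
    Summit.HodgeConjecture.HodgeConjecture.Ring2.WeilCoverage.SqrtNeg3.not_mem_34
  rw [mk0_mul_mk0] at h
  norm_num at h
  exact h

/-- The same datum, CELL IDENTIFICATION: `[det H|_B] = [-34]` in `ℚˣ/Nm(ℚ(√-3)ˣ)` — the census ROW KEY of `W6.3.34` (`a·34 = ((64 : ℚ) / 3) = ((0 : ℚ))² + 3·(((8 : ℚ) / 3))²`).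
research route conditional on HC_CM; not a corollary; Q11.4-sentence-2 already refuted in dim ≥ 3. [cite: vanGeemen1994HodgeAV, Lemma 5.2 (3)] -/
theorem fibre3_C3S34_n34_cfa4d1_mk_detH_eq_key :
    (QuotientGroup.mk (Units.mk0 (-(((32 : ℚ) / 51))) (neg_ne_zero.2 (by norm_num))) : weilNormResidueGroup 3) =
      QuotientGroup.mk (Units.mk0 (-(34 : ℚ)) (neg_ne_zero.2 (by norm_num))) :=
  mk_neg_eq_mk_neg_of_mul_mem (by norm_num) (by norm_num)
    (mem_normUnitsSubgroup_of_sq_add_mul_sq _ (0 : ℚ) ((8 : ℚ) / 3) (by norm_num))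

end Summit.HodgeConjecture.HodgeConjecture.Ring2.WeilCoverage
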